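import Summits.BirchSwinnertonDyer.Rank1Residual.GaloisImage.ElkiesGroupNineComplements
import Literature.NumberTheory.EllipticCurves.BSDSelmerPConverseSerreProofs
import Literature.NumberTheory.EllipticCurves.Kato2004.TorsionNonscalarWitnessProofs
import Literature.NumberTheory.EllipticCurves.Kato2004.Condition1252
import Summits.BirchSwinnertonDyer.Rank1Residual.GaloisImage.J1728NotSurjThree
import Summits.BirchSwinnertonDyer.Rank1Residual.GaloisImage.HauptmodulExoticSignatureLemmas
import HarnessLib

/-!
# THE CONVERSE: surj(3) and NO `3`-adic tower ⟹ the mod-`9` image is conjugate into Elkies' `G′`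
# — hence, modulo the ONE cited moduli sentence, EXOTIC ⟺ `j ∈ f(ℙ¹(ℚ))`
# (cell `b2b-bsdres`, team n1011, seat p10 gen 7 — row T-b11-ELK, FILE 1d; over FILES 1/1b/1c and
# the tree's frame / non-scalar-witness theorems; the X4@3 EXOTIC residue of RESIDUAL-MAP §I N11 / O8
# becomes, in the kernel and modulo `hmod`, EXACTLY Elkies' explicitly parametrised thin set)

HONEST FRAMING (cell `b2b-bsdres`, run/shared/lean/b2b/bsd-rank1-residual/, verbatim in every
file): the goal of the cell is to DELETE the COMBINATION-SHAPED residual classes of the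
Birch–Swinnerton-Dyer formula for ALL analytic-rank `≤ 1` elliptic curves over `ℚ` — "full BSD
formula for every rank `≤ 1` curve in class `C`" assembled STRICTLY from published theorems — so
that the rank-`≤ 1` remainder becomes exactly the CONSTRUCTION-SHAPED classes, which are TYPED
(missing-input `Prop`s), NOT attempted. This is not "finishing BSD". Team n1011 (N10 / N11):
research route; no claim beyond the stated classes; labels UNCHANGED; nothing is booked. Theorems
only (no definition, no named fact). The `j`-side corollaries are CONDITIONAL on the ONE cited named
fact `Elkies2006.modNineImage_conj_elkiesGroup_iff_j ℚ` (binder `hmod`, p281678), never discharged.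

## What this file proves

* `ElkiesNine.entries_scalar_of_cast_eq_one` — for `E/ℚ` with surj(3) and NO tower, a frame
  `e : E[9] ≃ (ℤ/9)²` with matrix representation `ρ`: every `τ ∈ Γ_ℚ` whose matrix is `≡ 1 (mod 3)`
  fixes `E[3] = 3·E[9]` pointwise, hence (lit-kato's `forall_hasSurjectiveModNGaloisRep_three_pow_of_
  fixing_torsion_of_nonscalar`, contraposed) acts on `E[9]` as a scalar `1 + 3m`: its matrix is
  `(1 + 3y)·I`.
* **`modNineImageConjElkies_of_surj_of_not_towerSurj (W) (hsurj : ρ̄_{E,3} onto)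
  (hnot : ¬ ∀ n, ρ̄_{E,3ⁿ} onto) : Elkies2006.ModNineImageConjElkies W`** — UNCONDITIONAL. Proof:
  frame of `E[9]` and its representation `ρ : Γ_ℚ →* GL₂(ℤ/9)` (tree: `nonempty_addEquiv_geomTorsion`,
  `exists_rep_of_addEquiv`); lifts `σ_a, σ_b` of `ā = (1 1; 0 1)`, `b̄ = (0 1; 1 0)` from surj(3)
  (`exists_map_eq_of_hasSurjectiveModNGaloisRep`); the relators `σ_a³, σ_b², (σ_aσ_b)⁸` reduce to `1`
  mod `3`, so their matrices are scalars `∈ {I, 4I, 7I}`; FILE 1c's kernel certificate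
  `exists_conj_into_elkiesGroupNine_of_relators` gives `g, g'` conjugating `s = ρ(σ_a)`, `t = ρ(σ_b)`
  into `G′`; for any `σ`, `ρ̄₃(σ) ∈ GL₂(𝔽₃) = ⟨ā, b̄⟩` (`mem_closure_gensModThree`) is `ρ̄₃(τ)` for some
  `τ` in the closure of `{σ_a, σ_b}`, `στ⁻¹` is a scalar `(1+3y)` on `E[9]`, and
  `g ρ(σ) g' = (1+3y)·(g ρ(τ) g') ∈ G′` (closure induction; `(1+3y)I ∈ G′`); the frame `g ∘ e`
  exhibits `ModNineImageConjElkies W`.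
* **`j_mem_elkiesJSet_of_surj_of_not_towerSurj (hmod) … : W.j ∈ elkiesJSet ℚ`** and the END
  **`not_towerSurj_three_iff_j_mem_elkiesJSet (hmod) (W) (h0 : j ≠ 0) (h1728 : j ≠ 1728)
  (hsurj) : (¬ ∀ n, ρ̄_{E,3ⁿ} onto) ↔ W.j ∈ f(ℙ¹(ℚ))`** — with surj(3), the `3`-adic tower FAILS iff
  `j` lies on Elkies' degree-27 family (modulo the cited moduli sentence): the cell's EXOTIC residue
  at `m = 3` is exactly the thin set `f(ℙ¹(ℚ)) ∖ {0, 1728}` intersected with surj(3).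
* **`not_towerSurj_three_iff_j_mem_elkiesJSet_of_surj (hmod) (W) (hsurj)`** — the same with `j ∉ {0,1728}`
  discharged from surj(3) (p02's `not_surj_three_of_j_eq_zero`, p14's `j_ne_1728_of_surj_three`);
  Kato spelling `not_imageContainsSL2_three_iff_j_mem_elkiesJSet_of_surj`.
What this does NOT do: discharge `hmod`; say anything at `j ∈ {0, 1728}` (surj(3) fails at `j = 0`
anyway); book anything; move a mark — X4 stays CONSTRUCTION-SHAPED, now with its EXOTIC piece NAMED.

References: [Elkies2006] §§0–3; [SutherlandZywina2017] Prop. 2.7; [RouseSutherlandZureickbrown2022]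
§2.3; [SerreAbelianLadic1968] IV-23; [SilvermanAEC2009] III.6.4, III.7; p14 `e11/EXO3-LOCAL-WITNESS.md`
§10 (the group-theoretic argument), lit p281678 (the moduli sentence).
-/

namespace Summit.BirchSwinnertonDyer.Rank1Residual.GaloisImage

open WeierstrassCurve Literature.NumberTheory.EllipticCurves
  Literature.NumberTheory.EllipticCurves.Elkies2006 Matrix

/-- **A Galois element whose matrix on `E[9]` is `≡ 1 (mod 3)` is a scalar `1 + 3y` on `E[9]`**, when
the `3`-adic tower fails and `ρ̄_{E,3}` is onto (lit-kato's non-scalar witness ⟹ tower, contraposed). [cite: SerreAbelianLadic1968, Ch. IV §3.4, Lemma 3 (IV-23)] [cite: Elkies2006, §1] -/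
theorem ElkiesNine.entries_scalar_of_cast_eq_one (W : WeierstrassCurve ℚ) [W.IsElliptic]
    (hsurj : W.HasSurjectiveModNGaloisRep 3) (hnot : ¬ ∀ n : ℕ, W.HasSurjectiveModNGaloisRep (3 ^ n : ℕ))
    (e : geomTorsion W ((3 ^ 2 : ℕ) : ℤ) ≃+ (Fin 2 → ZMod (3 ^ 2)))
    (ρ : Field.absoluteGaloisGroup ℚ →* GL (Fin 2) (ZMod (3 ^ 2)))
    (hρ : ∀ (σ : Field.absoluteGaloisGroup ℚ) (P : geomTorsion W ((3 ^ 2 : ℕ) : ℤ)),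
      e (σ • P) = ((ρ σ : GL (Fin 2) (ZMod (3 ^ 2))) : Matrix (Fin 2) (Fin 2) (ZMod (3 ^ 2))) *ᵥ e P)
    (τ : Field.absoluteGaloisGroup ℚ)
    (hτ : ∀ i j, ZMod.castHom (show 3 ∣ 9 by norm_num) (ZMod 3)
      (((ρ τ : GL (Fin 2) (ZMod 9)) : Matrix (Fin 2) (Fin 2) (ZMod 9)) i j) =
        (1 : Matrix (Fin 2) (Fin 2) (ZMod 3)) i j) :
    ∃ y : ZMod 9, (((ρ τ : GL (Fin 2) (ZMod 9)) : Matrix (Fin 2) (Fin 2) (ZMod 9)) 0 0,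
      ((ρ τ : GL (Fin 2) (ZMod 9)) : Matrix (Fin 2) (Fin 2) (ZMod 9)) 0 1,
      ((ρ τ : GL (Fin 2) (ZMod 9)) : Matrix (Fin 2) (Fin 2) (ZMod 9)) 1 0,
      ((ρ τ : GL (Fin 2) (ZMod 9)) : Matrix (Fin 2) (Fin 2) (ZMod 9)) 1 1) = (1 + 3 * y, 0, 0, 1 + 3 * y) := by
  set M : Matrix (Fin 2) (Fin 2) (ZMod 9) := ((ρ τ : GL (Fin 2) (ZMod 9)) : Matrix (Fin 2) (Fin 2) (ZMod 9))
    with hM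
  -- (1) τ fixes E[3] pointwise
  have hfix : ∀ P ∈ geomTorsion W 3, τ • P = P := by
    intro P hP
    have h3P : (3 : ℕ) • P = 0 := AddSubgroup.torsionBy.nsmul_iff.mp hP
    have hP9 : P ∈ geomTorsion W ((3 ^ 2 : ℕ) : ℤ) :=
      AddSubgroup.torsionBy.nsmul_iff.mpr (by rw [pow_two, mul_nsmul', h3P, nsmul_zero])
    set Q : geomTorsion W ((3 ^ 2 : ℕ) : ℤ) := ⟨P, hP9⟩ with hQ
    have h3v : ∀ i, (3 : ZMod 9) * e Q i = 0 := by
      intro i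
      have h3Q : (3 : ℕ) • Q = 0 := by
        apply Subtype.ext
        simp only [AddSubmonoidClass.coe_nsmul, ZeroMemClass.coe_zero, hQ]
        exact h3P
      have := congrArg (fun v : Fin 2 → ZMod (3 ^ 2) => v i) (map_nsmul e 3 Q)
      simp only [h3Q, map_zero, Pi.zero_apply, Pi.smul_apply, nsmul_eq_mul] at this
      simpa using this.symm
    have hMv : M *ᵥ e Q = e Q := by
      ext i
      fin_cases i
      · simp only [Matrix.mulVec, dotProduct, Fin.sum_univ_two, Fin.isValue]
        change M 0 0 * e Q 0 + M 0 1 * e Q 1 = e Q 0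
        rw [ElkiesNine.mul_eq_self_of_cast_one _ _ (by simpa [hM] using hτ 0 0) (h3v 0),
          ElkiesNine.mul_eq_zero_of_cast_zero _ _ (by simpa [hM] using hτ 0 1) (h3v 1), add_zero]
      · simp only [Matrix.mulVec, dotProduct, Fin.sum_univ_two, Fin.isValue]
        change M 1 0 * e Q 0 + M 1 1 * e Q 1 = e Q 1
        rw [ElkiesNine.mul_eq_zero_of_cast_zero _ _ (by simpa [hM] using hτ 1 0) (h3v 0),
          ElkiesNine.mul_eq_self_of_cast_one _ _ (by simpa [hM] using hτ 1 1) (h3v 1), zero_add]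
    have hτQ : τ • Q = Q := e.injective (by rw [hρ, ← hM, hMv])
    have := congrArg (fun R : geomTorsion W ((3 ^ 2 : ℕ) : ℤ) => (R : geomPoints W)) hτQ
    simpa [hQ] using this
  -- (2) hence τ is a scalar 1 + 3m on E[9]
  have hns : ∃ m : ℕ, ∀ Q ∈ geomTorsion W 9, τ • Q = (1 + 3 * m) • Q := by
    by_contra hns
    exact hnot (W.forall_hasSurjectiveModNGaloisRep_three_pow_of_fixing_torsion_of_nonscalar
      hsurj τ hfix hns)
  obtain ⟨m, hm⟩ := hns
  refine ⟨(m : ZMod 9), ?_⟩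
  -- M *ᵥ w = (1 + 3m) • w for all w
  have hMw : ∀ w : Fin 2 → ZMod (3 ^ 2), M *ᵥ w = ((1 + 3 * m : ℕ) : ZMod 9) • w := by
    intro w
    have hQ := hm (e.symm w) (e.symm w).2
    have h1 : e (τ • e.symm w) = M *ᵥ w := by rw [hρ, ← hM, e.apply_symm_apply]
    have h2 : (τ • e.symm w : geomTorsion W ((3 ^ 2 : ℕ) : ℤ)) = (1 + 3 * m) • e.symm w := by
      apply Subtype.ext
      simpa [AddSubgroupClass.coe_nsmul] using hQ
    rw [← h1, h2, map_nsmul, e.apply_symm_apply, ← Nat.cast_smul_eq_nsmul (ZMod 9)]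
  have hMeq : M = ((1 + 3 * m : ℕ) : ZMod 9) • (1 : Matrix (Fin 2) (Fin 2) (ZMod 9)) :=
    Matrix.toLin'.injective (LinearMap.ext fun w => by
      simp [Matrix.toLin'_apply, hMw w])
  have h00 : M 0 0 = 1 + 3 * (m : ZMod 9) := by rw [hMeq]; simp
  have h01 : M 0 1 = 0 := by rw [hMeq]; simp
  have h10 : M 1 0 = 0 := by rw [hMeq]; simp
  have h11 : M 1 1 = 1 + 3 * (m : ZMod 9) := by rw [hMeq]; simp
  rw [h00, h01, h10, h11]


/-- **THE CONVERSE (unconditional): surj(3) and no `3`-adic tower ⟹ the mod-`9` image of `Γ_ℚ` is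
conjugate into Elkies' `G′`** (`Elkies2006.ModNineImageConjElkies W`: a basis of `E[9]` in which every
`σ` acts through a matrix of `G′`). [cite: Elkies2006, §1 (G′ unique up to conjugation), §3 (image conjugate into G′)]
[cite: SerreAbelianLadic1968, Ch. IV §3.4, Lemma 3 (IV-23)] [cite: SilvermanAEC2009, III.6.4(b), III.7] -/
theorem modNineImageConjElkies_of_surj_of_not_towerSurj (W : WeierstrassCurve ℚ) [W.IsElliptic]
    (hsurj : W.HasSurjectiveModNGaloisRep 3) (hnot : ¬ ∀ n : ℕ, W.HasSurjectiveModNGaloisRep (3 ^ n : ℕ)) :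
    ModNineImageConjElkies W := by
  -- (1) a frame of E[9] and its matrix representation
  obtain ⟨e⟩ := nonempty_addEquiv_geomTorsion W 3 2 (by norm_num) (by norm_num)
  obtain ⟨ρ, hρ⟩ := exists_rep_of_addEquiv W e
  set c := ZMod.castHom (show 3 ∣ 9 by norm_num) (ZMod 3) with hc
  have hc' : c = ZMod.castHom (dvd_pow_self 3 (Nat.succ_ne_zero 1)) (ZMod 3) := rfl
  -- (2) lifts of ā = (1 1; 0 1) and b̄ = (0 1; 1 0)
  let A : GL (Fin 2) (ZMod 3) := ⟨!![1, 1; 0, 1], !![1, -1; 0, 1], by decide, by decide⟩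
  let B : GL (Fin 2) (ZMod 3) := ⟨!![0, 1; 1, 0], !![0, 1; 1, 0], by decide, by decide⟩
  obtain ⟨σa, hσa⟩ := exists_map_eq_of_hasSurjectiveModNGaloisRep W 3 1 (by norm_num) e ρ hρ hsurj A
  obtain ⟨σb, hσb⟩ := exists_map_eq_of_hasSurjectiveModNGaloisRep W 3 1 (by norm_num) e ρ hρ hsurj B
  set ψ : Field.absoluteGaloisGroup ℚ →* GL (Fin 2) (ZMod 3) :=
    (Matrix.GeneralLinearGroup.map c).comp ρ with hψ
  have hψa : ψ σa = A := hσa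
  have hψb : ψ σb = B := hσb
  -- entries of ψ τ
  have hentry : ∀ τ i j, c (((ρ τ : GL (Fin 2) (ZMod 9)) : Matrix (Fin 2) (Fin 2) (ZMod 9)) i j) =
      ((ψ τ : GL (Fin 2) (ZMod 3)) : Matrix (Fin 2) (Fin 2) (ZMod 3)) i j := fun τ i j => rfl
  set s : Matrix (Fin 2) (Fin 2) (ZMod 9) := ((ρ σa : GL (Fin 2) (ZMod 9)) : Matrix (Fin 2) (Fin 2) (ZMod 9))
    with hs_def
  set t : Matrix (Fin 2) (Fin 2) (ZMod 9) := ((ρ σb : GL (Fin 2) (ZMod 9)) : Matrix (Fin 2) (Fin 2) (ZMod 9))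
    with ht_def
  have hsa : ∀ i j, c (s i j) = (!![1, 1; 0, 1] : Matrix (Fin 2) (Fin 2) (ZMod 3)) i j := by
    intro i j; rw [hs_def, hentry, hψa]
  have hsb : ∀ i j, c (t i j) = (!![0, 1; 1, 0] : Matrix (Fin 2) (Fin 2) (ZMod 3)) i j := by
    intro i j; rw [ht_def, hentry, hψb]
  have hs₀₀ := ElkiesNine.mem_147_of_cast_eq_one _ (by simpa [hc] using hsa 0 0)
  have hs₀₁ := ElkiesNine.mem_147_of_cast_eq_one _ (by simpa [hc] using hsa 0 1)
  have hs₁₀ := ElkiesNine.mem_036_of_cast_eq_zero _ (by simpa [hc] using hsa 1 0)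
  have hs₁₁ := ElkiesNine.mem_147_of_cast_eq_one _ (by simpa [hc] using hsa 1 1)
  have ht₀₀ := ElkiesNine.mem_036_of_cast_eq_zero _ (by simpa [hc] using hsb 0 0)
  have ht₀₁ := ElkiesNine.mem_147_of_cast_eq_one _ (by simpa [hc] using hsb 0 1)
  have ht₁₀ := ElkiesNine.mem_147_of_cast_eq_one _ (by simpa [hc] using hsb 1 0)
  have ht₁₁ := ElkiesNine.mem_036_of_cast_eq_zero _ (by simpa [hc] using hsb 1 1)
  -- (3) relators: an element with ψ = 1 is a scalar 1 + 3y on E[9]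
  have hscalar : ∀ τ, ψ τ = 1 → ∃ y : ZMod 9,
      (((ρ τ : GL (Fin 2) (ZMod 9)) : Matrix (Fin 2) (Fin 2) (ZMod 9)) 0 0,
       ((ρ τ : GL (Fin 2) (ZMod 9)) : Matrix (Fin 2) (Fin 2) (ZMod 9)) 0 1,
       ((ρ τ : GL (Fin 2) (ZMod 9)) : Matrix (Fin 2) (Fin 2) (ZMod 9)) 1 0,
       ((ρ τ : GL (Fin 2) (ZMod 9)) : Matrix (Fin 2) (Fin 2) (ZMod 9)) 1 1) = (1 + 3 * y, 0, 0, 1 + 3 * y) := by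
    intro τ hτ
    exact ElkiesNine.entries_scalar_of_cast_eq_one W hsurj hnot e ρ hρ τ (fun i j => by
      rw [hentry, hτ]; rfl)
  have hA3 : A ^ 3 = 1 := Units.ext (by decide)
  have hB2 : B ^ 2 = 1 := Units.ext (by decide)
  have hAB8 : (A * B) ^ 8 = 1 := Units.ext (by decide)
  have h3 : ((s ^ 3) 0 0, (s ^ 3) 0 1, (s ^ 3) 1 0, (s ^ 3) 1 1) ∈
      ([(1, 0, 0, 1), (4, 0, 0, 4), (7, 0, 0, 7)] : List (ZMod 9 × ZMod 9 × ZMod 9 × ZMod 9)) := by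
    obtain ⟨y, hy⟩ := hscalar (σa ^ 3) (by rw [map_pow, hψa, hA3])
    have : s ^ 3 = ((ρ (σa ^ 3) : GL (Fin 2) (ZMod 9)) : Matrix (Fin 2) (Fin 2) (ZMod 9)) := by
      rw [map_pow, Units.val_pow_eq_pow_val]
    rw [this, hy]; exact ElkiesNine.scalar_tuple_mem y
  have h2 : ((t ^ 2) 0 0, (t ^ 2) 0 1, (t ^ 2) 1 0, (t ^ 2) 1 1) ∈
      ([(1, 0, 0, 1), (4, 0, 0, 4), (7, 0, 0, 7)] : List (ZMod 9 × ZMod 9 × ZMod 9 × ZMod 9)) := by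
    obtain ⟨y, hy⟩ := hscalar (σb ^ 2) (by rw [map_pow, hψb, hB2])
    have : t ^ 2 = ((ρ (σb ^ 2) : GL (Fin 2) (ZMod 9)) : Matrix (Fin 2) (Fin 2) (ZMod 9)) := by
      rw [map_pow, Units.val_pow_eq_pow_val]
    rw [this, hy]; exact ElkiesNine.scalar_tuple_mem y
  have h8 : (((s * t) ^ 8) 0 0, ((s * t) ^ 8) 0 1, ((s * t) ^ 8) 1 0, ((s * t) ^ 8) 1 1) ∈
      ([(1, 0, 0, 1), (4, 0, 0, 4), (7, 0, 0, 7)] : List (ZMod 9 × ZMod 9 × ZMod 9 × ZMod 9)) := by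
    obtain ⟨y, hy⟩ := hscalar ((σa * σb) ^ 8) (by rw [map_pow, map_mul, hψa, hψb, hAB8])
    have : (s * t) ^ 8 = ((ρ ((σa * σb) ^ 8) : GL (Fin 2) (ZMod 9)) : Matrix (Fin 2) (Fin 2) (ZMod 9)) := by
      rw [map_pow, map_mul, Units.val_pow_eq_pow_val, Units.val_mul]
    rw [this, hy]; exact ElkiesNine.scalar_tuple_mem y
  -- (4) the conjugator
  obtain ⟨g, g', hgg', hg'g, hgs, hgt⟩ := exists_conj_into_elkiesGroupNine_of_relators s t
    hs₀₀ hs₀₁ hs₁₀ hs₁₁ ht₀₀ ht₀₁ ht₁₀ ht₁₁ h3 h2 h8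
  -- (5) every ρ σ conjugates into G′
  have hall : ∀ σ, g * ((ρ σ : GL (Fin 2) (ZMod 9)) : Matrix (Fin 2) (Fin 2) (ZMod 9)) * g' ∈
      elkiesGroupNine := by
    intro σ
    -- (5a) ψ σ is a product of A, B: find τ in the closure of {σa, σb} with ψ τ = ψ σ
    have hu : ((ψ σ : GL (Fin 2) (ZMod 3)) : Matrix (Fin 2) (Fin 2) (ZMod 3)) ∈
        Submonoid.closure ({!![1, 1; 0, 1], !![0, 1; 1, 0]} : Set (Matrix (Fin 2) (Fin 2) (ZMod 3))) :=
      ElkiesNine.mem_closure_gensModThree _ (by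
        rw [← Matrix.GeneralLinearGroup.val_det_apply]; exact Units.ne_zero _)
    have himage : Submonoid.closure ({!![1, 1; 0, 1], !![0, 1; 1, 0]} : Set (Matrix (Fin 2) (Fin 2) (ZMod 3)))
        = Submonoid.map ((Units.coeHom _).comp ψ) (Submonoid.closure {σa, σb}) := by
      rw [MonoidHom.map_mclosure]
      congr 1
      ext x
      simp only [Set.mem_insert_iff, Set.mem_singleton_iff, Set.mem_image, MonoidHom.coe_comp,
        Function.comp_apply, Units.coeHom_apply]
      constructor
      · rintro (rfl | rfl)
        · exact ⟨σa, Or.inl rfl, by rw [hψa]⟩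
        · exact ⟨σb, Or.inr rfl, by rw [hψb]⟩
      · rintro ⟨τ, (rfl | rfl), rfl⟩
        · exact Or.inl (by rw [hψa])
        · exact Or.inr (by rw [hψb])
    rw [himage, Submonoid.mem_map] at hu
    obtain ⟨τ, hτmem, hτ⟩ := hu
    -- (5b) σ τ⁻¹ maps to 1, hence is a scalar 1 + 3y on E[9]
    have hστ : ψ (σ * τ⁻¹) = 1 := by
      rw [map_mul, map_inv]
      have : ψ τ = ψ σ := Units.ext (by simpa using hτ)
      rw [this, mul_inv_cancel]
    obtain ⟨y, hy⟩ := hscalar (σ * τ⁻¹) hστ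
    have hdec : ((ρ σ : GL (Fin 2) (ZMod 9)) : Matrix (Fin 2) (Fin 2) (ZMod 9)) =
        ((1 + 3 * y) • (1 : Matrix (Fin 2) (Fin 2) (ZMod 9))) *
          ((ρ τ : GL (Fin 2) (ZMod 9)) : Matrix (Fin 2) (Fin 2) (ZMod 9)) := by
      have hστ' : σ = (σ * τ⁻¹) * τ := by group
      have hM : ((ρ (σ * τ⁻¹) : GL (Fin 2) (ZMod 9)) : Matrix (Fin 2) (Fin 2) (ZMod 9)) =
          (1 + 3 * y) • (1 : Matrix (Fin 2) (Fin 2) (ZMod 9)) := by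
        simp only [Prod.mk.injEq] at hy
        obtain ⟨h00, h01, h10, h11⟩ := hy
        ext i j
        fin_cases i <;> fin_cases j
        · simpa [Matrix.smul_apply] using h00
        · simpa [Matrix.smul_apply] using h01
        · simpa [Matrix.smul_apply] using h10
        · simpa [Matrix.smul_apply] using h11
      conv_lhs => rw [hστ', map_mul, Units.val_mul, hM]
    -- (5c) g ρτ g' ∈ G′ by closure induction
    have hτG : g * ((ρ τ : GL (Fin 2) (ZMod 9)) : Matrix (Fin 2) (Fin 2) (ZMod 9)) * g' ∈
        elkiesGroupNine := by
      refine Submonoid.closure_induction (motive := fun x _ =>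
        g * ((ρ x : GL (Fin 2) (ZMod 9)) : Matrix (Fin 2) (Fin 2) (ZMod 9)) * g' ∈ elkiesGroupNine)
        ?_ ?_ ?_ hτmem
      · rintro x (rfl | rfl)
        · exact hgs
        · exact hgt
      · simpa [hgg'] using one_mem_elkiesGroupNine
      · intro x z _ _ hx hz
        have : g * ((ρ (x * z) : GL (Fin 2) (ZMod 9)) : Matrix (Fin 2) (Fin 2) (ZMod 9)) * g' =
            (g * ((ρ x : GL (Fin 2) (ZMod 9)) : Matrix (Fin 2) (Fin 2) (ZMod 9)) * g') *
            (g * ((ρ z : GL (Fin 2) (ZMod 9)) : Matrix (Fin 2) (Fin 2) (ZMod 9)) * g') := by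
          rw [map_mul, Units.val_mul]
          simp only [mul_assoc]
          rw [← mul_assoc g' g, hg'g, one_mul]
        rw [this]
        exact mul_mem_elkiesGroupNine hx hz
    -- (5d) scalars
    rw [hdec]
    have : g * ((1 + 3 * y) • (1 : Matrix (Fin 2) (Fin 2) (ZMod 9)) *
        ((ρ τ : GL (Fin 2) (ZMod 9)) : Matrix (Fin 2) (Fin 2) (ZMod 9))) * g' =
        ((1 + 3 * y) • (1 : Matrix (Fin 2) (Fin 2) (ZMod 9))) *
          (g * ((ρ τ : GL (Fin 2) (ZMod 9)) : Matrix (Fin 2) (Fin 2) (ZMod 9)) * g') := by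
      simp only [smul_mul_assoc, mul_smul_comm, one_mul, mul_assoc]
    rw [this]
    exact mul_mem_elkiesGroupNine (ElkiesNine.scalar_mem_elkiesGroupNine y) hτG
  -- (6) the new frame
  let gE : (Fin 2 → ZMod 9) ≃+ (Fin 2 → ZMod 9) :=
    { toFun := fun v => g *ᵥ v
      invFun := fun v => g' *ᵥ v
      left_inv := fun v => by
        show g' *ᵥ (g *ᵥ v) = v
        rw [Matrix.mulVec_mulVec, hg'g, Matrix.one_mulVec]
      right_inv := fun v => by
        show g *ᵥ (g' *ᵥ v) = v
        rw [Matrix.mulVec_mulVec, hgg', Matrix.one_mulVec]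
      map_add' := fun v w => Matrix.mulVec_add _ _ _ }
  refine ⟨e.trans gE, fun σ => ⟨_, hall σ, fun P => ?_⟩⟩
  show g *ᵥ e (σ • P) = (g * _ * g') *ᵥ (g *ᵥ e P)
  rw [hρ, Matrix.mulVec_mulVec, Matrix.mulVec_mulVec, mul_assoc (g * _), hg'g, mul_one]


/-- **EXOTIC ⟹ `j ∈ f(ℙ¹(ℚ))`** (modulo the ONE cited moduli sentence `hmod`): an elliptic curve over `ℚ`
with `ρ̄_{E,3}` onto, NO `3`-adic tower and `j ∉ {0, 1728}` has `j`-invariant on Elkies' degree-27 family.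
[cite: SutherlandZywina2017, Prop. 2.7] [cite: Elkies2006, §§0–3] -/
theorem j_mem_elkiesJSet_of_surj_of_not_towerSurj (hmod : modNineImage_conj_elkiesGroup_iff_j ℚ)
    (W : WeierstrassCurve ℚ) [W.IsElliptic] (h0 : W.j ≠ 0) (h1728 : W.j ≠ 1728)
    (hsurj : W.HasSurjectiveModNGaloisRep 3) (hnot : ¬ ∀ n : ℕ, W.HasSurjectiveModNGaloisRep (3 ^ n : ℕ)) :
    W.j ∈ elkiesJSet ℚ :=
  mem_elkiesJSet_of_modNineImageConjElkies hmod W h0 h1728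
    (modNineImageConjElkies_of_surj_of_not_towerSurj W hsurj hnot)

/-- **END — the EXOTIC residue NAMED: with surj(3) and `j ∉ {0, 1728}`, the `3`-adic tower FAILS iff
`j ∈ f(ℙ¹(ℚ))`** (Elkies' family; modulo the ONE cited moduli sentence `hmod`). The (⟸) direction is
FILE 1's `not_towerSurj_three_of_modNineImageConjElkies` with the fact's (⟸); the (⟹) direction is this
file. [cite: Elkies2006, §§0–3] [cite: SutherlandZywina2017, Prop. 2.7] [cite: SerreAbelianLadic1968, Ch. IV §3.4, Lemma 3 (IV-23)] -/
theorem not_towerSurj_three_iff_j_mem_elkiesJSet (hmod : modNineImage_conj_elkiesGroup_iff_j ℚ)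
    (W : WeierstrassCurve ℚ) [W.IsElliptic] (h0 : W.j ≠ 0) (h1728 : W.j ≠ 1728)
    (hsurj : W.HasSurjectiveModNGaloisRep 3) :
    (¬ ∀ n : ℕ, W.HasSurjectiveModNGaloisRep (3 ^ n : ℕ)) ↔ W.j ∈ elkiesJSet ℚ :=
  ⟨j_mem_elkiesJSet_of_surj_of_not_towerSurj hmod W h0 h1728 hsurj,
    fun hj => not_towerSurj_three_of_modNineImageConjElkies W
      (modNineImageConjElkies_of_mem hmod W h0 h1728 hj)⟩

/-- The same END in Kato's spelling: with surj(3) and `j ∉ {0, 1728}`, Kato's (12.5.2) at `3` FAILS iff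
`j ∈ f(ℙ¹(ℚ))` (mod `hmod`). [cite: Kato2004Asterisque, (12.5.2) in Thm. 12.5 (4) (p. 222)] [cite: Elkies2006, §§0–3] -/
theorem not_imageContainsSL2_three_iff_j_mem_elkiesJSet (hmod : modNineImage_conj_elkiesGroup_iff_j ℚ)
    (W : WeierstrassCurve ℚ) [W.IsElliptic] (h0 : W.j ≠ 0) (h1728 : W.j ≠ 1728)
    (hsurj : W.HasSurjectiveModNGaloisRep 3) :
    (¬ Kato2004.ImageContainsSL2 W 3) ↔ W.j ∈ elkiesJSet ℚ := by
  haveI : Fact (Nat.Prime 3) := ⟨Nat.prime_three⟩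
  rw [Kato2004.imageContainsSL2_iff_forall_hasSurjectiveModNGaloisRep]
  exact not_towerSurj_three_iff_j_mem_elkiesJSet hmod W h0 h1728 hsurj

/-- **END, binder-free form under surj(3)**: `j ≠ 0` (p02's `not_surj_three_of_j_eq_zero`) and
`j ≠ 1728` (p14's `j_ne_1728_of_surj_three`) are automatic when `ρ̄_{E,3}` is onto, so: for `E/ℚ` with
surj(3), **the `3`-adic tower FAILS iff `j ∈ f(ℙ¹(ℚ))`** (modulo the ONE cited moduli sentence `hmod`).
[cite: Elkies2006, §§0–3] [cite: SutherlandZywina2017, Prop. 2.7] [cite: SerreAbelianLadic1968, Ch. IV §3.4, Lemma 3 (IV-23)] -/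
theorem not_towerSurj_three_iff_j_mem_elkiesJSet_of_surj (hmod : modNineImage_conj_elkiesGroup_iff_j ℚ)
    (W : WeierstrassCurve ℚ) [W.IsElliptic] (hsurj : W.HasSurjectiveModNGaloisRep 3) :
    (¬ ∀ n : ℕ, W.HasSurjectiveModNGaloisRep (3 ^ n : ℕ)) ↔ W.j ∈ elkiesJSet ℚ :=
  haveI : Fact (Nat.Prime 3) := ⟨Nat.prime_three⟩
  not_towerSurj_three_iff_j_mem_elkiesJSet hmod W (fun h0 => not_surj_three_of_j_eq_zero W h0 hsurj)
    (j_ne_1728_of_surj_three W hsurj) hsurj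

/-- The same in Kato's spelling: for `E/ℚ` with surj(3), (12.5.2) at `3` FAILS iff `j ∈ f(ℙ¹(ℚ))`
(mod `hmod`) — the EXOTIC residue of the cell's `3`-adic census NAMED.
[cite: Kato2004Asterisque, (12.5.2) in Thm. 12.5 (4) (p. 222)] [cite: Elkies2006, §§0–3] -/
theorem not_imageContainsSL2_three_iff_j_mem_elkiesJSet_of_surj
    (hmod : modNineImage_conj_elkiesGroup_iff_j ℚ) (W : WeierstrassCurve ℚ) [W.IsElliptic]
    (hsurj : W.HasSurjectiveModNGaloisRep 3) :
    (¬ Kato2004.ImageContainsSL2 W 3) ↔ W.j ∈ elkiesJSet ℚ := by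
  haveI : Fact (Nat.Prime 3) := ⟨Nat.prime_three⟩
  rw [Kato2004.imageContainsSL2_iff_forall_hasSurjectiveModNGaloisRep]
  exact not_towerSurj_three_iff_j_mem_elkiesJSet_of_surj hmod W hsurj

end Summit.BirchSwinnertonDyer.Rank1Residual.GaloisImage
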